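import Literature.NumberTheory.GaloisRepresentations.GaloisRep
import Literature.NumberTheory.GaloisRepresentations.FramedRepTwist
import HarnessLib

/-!
# Twists of framed representations by characters: trace, determinant, functoriality, localisation

Topic `NumberTheory/GaloisRepresentations`.  Theorems only (no definition, no named fact):
complements to `FramedRepTwist.lean`, whose `FramedRep.twist ρ χ : g ↦ χ(g) · ρ(g)` is THE tree's
twist `ρ ⊗ χ` of a framed continuous representation `ρ : G →ₜ* GL_n(A)`
(`Literature.NumberTheory.GaloisRepresentations.FramedRep`) by a continuous character
`χ : G →ₜ* Aˣ` (as a matrix `(ρ ⊗ χ)(g) = χ(g) • ρ(g)`, `FramedRep.coe_twist_apply`).  Recorded here,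
all elementary and fully proved:

* `FramedRep.trace_twist` — `tr (ρ ⊗ χ)(g) = χ(g) · tr ρ(g)` (the identity behind "twisting a
  trace relation", e.g. of a polarisation `tr ρ(θ_c σ) = …`);
* `FramedRep.det_twist` — `det (ρ ⊗ χ) = χⁿ · det ρ` as continuous characters `G →ₜ* Aˣ`
  (pointwise: `FramedRep.det_twist_apply` of `FramedRepTwist.lean`);
* `FramedRep.twist_comp` — twisting commutes with composition along a continuous homomorphism
  `f : H →ₜ* G`: `(ρ ⊗ χ) ∘ f = (ρ ∘ f) ⊗ (χ ∘ f)`; hence, for Galois representations, with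
  restriction to `Γ_L` (`FramedGaloisRep.restrictField`, the tree's
  `FramedGaloisRep.restrictField_twist`), to a decomposition group `Γ_{K_v}`
  (`FramedGaloisRep.toLocal_twist`) and to `Γ_{K_w}` at an infinite place
  (`FramedGaloisRep.toInfinite_twist`), the character being restricted along the same map
  `absGaloisRestrict`; likewise for the conjugate `ρ^τ = ρ ∘ θ_τ` (`FramedGaloisRep.outerConj` of
  `AbsGaloisOuterConj.lean`, a `comp`, so `twist_comp` applies verbatim: `(ρ ⊗ χ)^τ = ρ^τ ⊗ χ^τ`);
* `FramedRep.twist_comm`, `FramedRep.twist_inv_twist`, `FramedRep.twist_left_inj`,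
  `FramedRep.twist_eq_iff_eq_twist_inv` — bookkeeping for "untwisting" (`ρ' = ρ ⊗ χ ↔ ρ = ρ' ⊗ χ⁻¹`);
* `FramedRep.dual_twist` — `(ρ ⊗ χ)^∨ = ρ^∨ ⊗ χ⁻¹` for the inverse-transpose dual `FramedRep.dual`.

Already in the tree and NOT restated: `twist_apply`, `coe_twist_apply`, `det_twist_apply`,
`twist_one`, `twist_twist`, `twist_twist_inv`, `conj_twist` (`FramedRepTwist.lean`);
`FramedGaloisRep.restrictField_twist` (`AbsIrreducibleIndexTwo.lean`);
`FramedGaloisRep.isUnramifiedAt_twist`, `FramedGaloisRep.hasFrobCharpolyAt_twist_of_eq_prod`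
(`TateTwistFrobeniusProofs.lean`); `FramedRep.isAbsolutelyIrreducible_twist_iff`,
`FramedRep.baseChangeRepresentation_twist` (`Automorphic/BCDTTheoremBNormalisedAssembly.lean`);
residual representations of twists (`ResidualRepTwist.lean`).

## References

* J.-P. Serre, *Abelian ℓ-adic representations and elliptic curves* (1968), Ch. I §1.1, §2.1
  (restriction to decomposition groups). [SerreAbelianLadic1968]
* J.-P. Serre, *Sur les représentations modulaires de degré 2 de Gal(ℚ̄/ℚ)*, Duke Math. J. 54
  (1987), §2.2 (twists `ρ ⊗ χ^m`). [Serre1987Duke]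
-/

noncomputable section

open scoped NumberField
open Field IsDedekindDomain

namespace Literature.NumberTheory.GaloisRepresentations

universe u v

/-! ### §1 Twists over a general topological group -/

section General

variable {G H : Type*} [Group G] [TopologicalSpace G] [Group H] [TopologicalSpace H]
  {A : Type*} [CommRing A] [TopologicalSpace A] [IsTopologicalRing A] {n : ℕ}

namespace FramedRep

/-- **Trace of a twist**: `tr (ρ ⊗ χ)(g) = χ(g) · tr ρ(g)` (`Matrix.trace_smul`). [folklore] -/
theorem trace_twist (ρ : FramedRep G A n) (χ : G →ₜ* Aˣ) (g : G) :
    FramedRep.trace (ρ.twist χ) g = (χ g : A) * FramedRep.trace ρ g := by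
  simp only [FramedRep.trace, coe_twist_apply, Matrix.trace_smul, smul_eq_mul]

/-- **Determinant of a twist, as a character**: `det (ρ ⊗ χ) = χⁿ · det ρ` in the commutative group
of continuous characters `G →ₜ* Aˣ`. [folklore] -/
theorem det_twist (ρ : FramedRep G A n) (χ : G →ₜ* Aˣ) :
    FramedRep.det (ρ.twist χ) = χ ^ n * FramedRep.det ρ :=
  ContinuousMonoidHom.ext fun g ↦ by
    rw [ContinuousMonoidHom.mul_apply, ContinuousMonoidHom.pow_apply, det_apply, det_apply,
      det_twist_apply]

/-- **Twisting commutes with composition**: `(ρ ⊗ χ) ∘ f = (ρ ∘ f) ⊗ (χ ∘ f)` for a continuous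
homomorphism `f : H →ₜ* G` (definitional). [folklore] -/
theorem twist_comp (ρ : FramedRep G A n) (χ : G →ₜ* Aˣ) (f : H →ₜ* G) :
    (ρ.twist χ).comp f = FramedRep.twist (ρ.comp f) (χ.comp f) :=
  ContinuousMonoidHom.ext fun _ ↦ rfl

/-- Twists by two characters commute: `(ρ ⊗ χ₁) ⊗ χ₂ = (ρ ⊗ χ₂) ⊗ χ₁`. [folklore] -/
theorem twist_comm (ρ : FramedRep G A n) (χ₁ χ₂ : G →ₜ* Aˣ) :
    (ρ.twist χ₁).twist χ₂ = (ρ.twist χ₂).twist χ₁ := by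
  rw [twist_twist, twist_twist, mul_comm χ₂ χ₁]

/-- `(ρ ⊗ χ⁻¹) ⊗ χ = ρ`. [folklore] -/
theorem twist_inv_twist (ρ : FramedRep G A n) (χ : G →ₜ* Aˣ) : (ρ.twist χ⁻¹).twist χ = ρ := by
  rw [twist_twist, mul_inv_cancel, twist_one]

/-- Twisting by a fixed character is injective: `ρ₁ ⊗ χ = ρ₂ ⊗ χ ↔ ρ₁ = ρ₂`. [folklore] -/
theorem twist_left_inj {ρ₁ ρ₂ : FramedRep G A n} (χ : G →ₜ* Aˣ) :
    ρ₁.twist χ = ρ₂.twist χ ↔ ρ₁ = ρ₂ :=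
  ⟨fun h ↦ by rw [← twist_twist_inv ρ₁ χ, h, twist_twist_inv], fun h ↦ h ▸ rfl⟩

/-- **Untwisting**: `ρ₁ ⊗ χ = ρ₂ ↔ ρ₁ = ρ₂ ⊗ χ⁻¹`. [folklore] -/
theorem twist_eq_iff_eq_twist_inv {ρ₁ ρ₂ : FramedRep G A n} (χ : G →ₜ* Aˣ) :
    ρ₁.twist χ = ρ₂ ↔ ρ₁ = ρ₂.twist χ⁻¹ := by
  rw [← twist_left_inj χ⁻¹, twist_twist_inv]

/-- **Dual of a twist**: `(ρ ⊗ χ)^∨ = ρ^∨ ⊗ χ⁻¹` for the inverse-transpose dual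
(`((χ(g) ρ(g))⁻¹)ᵀ = χ(g)⁻¹ ((ρ(g))⁻¹)ᵀ`, scalars being central). [folklore] -/
theorem dual_twist (ρ : FramedRep G A n) (χ : G →ₜ* Aˣ) : (ρ.twist χ).dual = ρ.dual.twist χ⁻¹ := by
  refine ContinuousMonoidHom.ext fun g ↦ Units.ext ?_
  have h1 : (ρ.twist χ g)⁻¹ = scalar A n (χ g)⁻¹ * (ρ g)⁻¹ := by
    rw [twist_apply, mul_inv_rev, ← map_inv (scalar A n) (χ g), scalar_mul_comm]
  rw [coe_dual_apply, h1, Units.val_mul, coe_scalar_apply, ← Algebra.smul_def,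
    Matrix.transpose_smul, coe_twist_apply, coe_dual_apply]
  rfl

end FramedRep

end General

/-! ### §2 Galois representations: twisting commutes with localisation -/

section Galois

variable {K : Type u} [Field K] {A : Type v} [CommRing A] [TopologicalSpace A]
  [IsTopologicalRing A] {n : ℕ}

namespace FramedGaloisRep

/-- **Twisting commutes with restriction to `Γ_{K_w}` at an infinite place `w`**:
`(ρ ⊗ χ)|_{Γ_{K_w}} = ρ|_{Γ_{K_w}} ⊗ χ|_{Γ_{K_w}}`, the character restricted along the same map
`absGaloisRestrict K K_w` (definitional).
Ref: Serre, *Abelian ℓ-adic representations* (1968), Ch. I §2.2. [folklore] -/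
theorem toInfinite_twist (w : NumberField.InfinitePlace K) (ρ : FramedGaloisRep K A n)
    (χ : absoluteGaloisGroup K →ₜ* Aˣ) :
    FramedGaloisRep.toInfinite w (FramedRep.twist ρ χ) =
      FramedRep.twist (ρ.toInfinite w) (χ.comp (absGaloisRestrict K w.Completion)) :=
  ContinuousMonoidHom.ext fun _ ↦ rfl

variable [NumberField K]

/-- **Twisting commutes with restriction to a decomposition group**:
`(ρ ⊗ χ)|_{Γ_{K_v}} = ρ|_{Γ_{K_v}} ⊗ χ|_{Γ_{K_v}}` at a finite place `v` of the number field `K`,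
the character restricted along the same map `absGaloisRestrict K K_v`, `K_v = v.adicCompletion K`
(definitional).
Ref: Serre, *Abelian ℓ-adic representations* (1968), Ch. I §2.1. [folklore] -/
theorem toLocal_twist (v : HeightOneSpectrum (𝓞 K)) (ρ : FramedGaloisRep K A n)
    (χ : absoluteGaloisGroup K →ₜ* Aˣ) :
    FramedGaloisRep.toLocal v (FramedRep.twist ρ χ) =
      FramedRep.twist (ρ.toLocal v) (χ.comp (absGaloisRestrict K (v.adicCompletion K))) :=
  ContinuousMonoidHom.ext fun _ ↦ rfl

end FramedGaloisRep

end Galois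

end Literature.NumberTheory.GaloisRepresentations

end
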